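import Literature.MathematicalPhysics.QuantumFieldTheory.Balaban1983to89.B1Eq324BenfattoAppendixDClustering
import Literature.MathematicalPhysics.QuantumFieldTheory.Balaban1983to89.HiggsFluctMeasureWickPairingSum
import Literature.MathematicalPhysics.QuantumFieldTheory.Balaban1983to89.B1Eq324BenfattoMarkov
import HarnessLib

/-!
# `Balaban1983to89.B1Eq324BenfattoAppendixDWick` — [BenfattoEtAl1978] Appendix D p. 166, point ii) for THE CONDITIONED FREE FIELD:
# Wick's theorem WITH A SOURCE (the moments of monomials of `P̄(dz|z̄_Γ)` are sums over set partitions of the legs into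
# sources `u(x_l)` and propagators `C^Γ(x_a,x_b)`), the identification with p13's diagram moments, and APPENDIX D'S BOUND:
# the joint truncated expectations of monomial clusters under `P̄` decay exponentially in the distance of the legs — PROVED

statement-level skeleton of published theorems with citation tags; proofs where landed; nothing here is a claim about the
Yang–Mills mass gap

WHY THIS MODULE (cell `pub-ymgap`, seat `dag-n08-b`, node N08 «first missing estimate» lane; sequel of
`B1Eq324BenfattoAppendixDClustering`, the combinatorial half).  Appendix D of [BenfattoEtAl1978] (p. 166, verbatim): *"ii)
𝓔^T_0(z^{A₁}, z^{A₂}, z^{A₃}; 1, 1, 1) is by definition an algebraic sum of products of expectations values. As it is well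
known, once these expectations are expressed via the Wick theorem as sum of products of 2-point functions, the only terms that
survive are the so called "connected diagrams" where at least one z_Δ in each set z^{A₁}, z^{A₂}, z^{A₃} is connected to another
z_Δ belonging to a different set. If we recall now that at least one z_Δ in each term of Ψ̃″₁ belong to □′∖Γ₄(□) the
exponential factors arising from i) and ii) give rise to an overall dumping factor that is at least exp −(ϰ/4)b^{3/2} …"*.
In §5 the expectations are the CONDITIONAL ones `𝓔_{z_{Γ₁}}` (p. 157: «trying to replace the conditional expectation 𝓔_{z_{Γ₁}} by
the unconditioned one»; (5.29)'s second term «from the properties of the conditioned measure and from the Wick theorem»), i.e.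
the field is the tree's `condField d α β Γ z̄` = the centred kernel field of the conditional covariance `C^Γ = condCov` SHIFTED by
the regression mean `u = condMean` ((C.6)–(C.7)).  A Gaussian field with a MEAN has Wick's theorem with SOURCE insertions: the
moment of a product of coordinates is the sum over the set partitions of the legs into singletons (each contributing `u(x_l)`)
and pairs (each contributing `C^Γ(x_a, x_b)`) — exactly p13's `LegDiagram.dmoment` with those block weights and no observable.
The sibling proved that the Ursell function of such diagram moments (= the connected diagrams) is exponentially small in the
leg distance; this file supplies the measure-theoretic identification and states Appendix D's bound for `condField`.

DICTIONARY.  `P̄(dz_□|z_{Γ₁})` ↦ `condField d α β Γ z̄`; a monomial cluster `z^{A_j} = Π_{l : own l = j} z_{Δ_{x_l}}` ↦ legs `l : Λ`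
(`own : Λ → J`, positions `x : Λ → Q₀`, `Λ` linearly ordered for the pairing enumeration); «2-point functions» ↦ `C^Γ(x_a,x_b)`;
the mean insertions (absent in print's centred notation `𝓔₀`, present for the conditioned measure) ↦ singleton blocks `u(x_l)`;
`𝓔^T(z^{A_j}, j ∈ J)` ↦ `LatticeModels.ursellOf (P ↦ ∫ Π_{l∈legs P} z(x_l) dP̄) (allV J)`.

WHAT IS PROVED (theorems only; no definition, no named fact, no `sorry`; axioms standard).
* §1 (private `sum_setPartitions_block_step`: block decomposition at a leg for weights without blocks of ≥ 3 legs) ★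
  **`sum_setPartitions_eq_sum_powerset_pairs`** — SOURCES AND PAIRS: `Σ_{τ∈𝒫(s)}Π_Bw(B) = Σ_{t⊆s}(Π_{l∈t}w{l})·Σ_{ρ∈𝒫(s∖t)}Π_B w₂(B)`,
  `w₂ = w·[|B|=2]` (strong induction at the least leg, the pattern of typer's `wickSum_eq_sum_setPartitions`).
* §2 ★ **`integral_prod_shift_eq_sum_powerset`** / **`integral_prod_shift_eq_sum_setPartitions`** — WICK WITH A SOURCE for the
  shifted kernel field `(μ_K).map (u + ·)`: `∫Π_{l∈s}z(x_l) = Σ_{t⊆s}(Π_{t}u(x_l))·wickSum(K∘x)(s∖t) = Σ_{τ∈𝒫(s)}Π_{B∈τ}w(B)`,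
  `w{l} = u(x_l)`, `w{a,b} = K(x_a,x_b)`, `0` on larger blocks (`integral_map` + `Finset.prod_add` +
  `HiggsFluctMeasureWickPairingSum.integral_finsetProd_eval_eq_wickSum` + §1).
* §3 **`integral_prod_eval_condField_eq_sum_setPartitions`** — the same for `condField d α β Γ z̄` (`K = condCov`, psd by
  `B1Eq324BenfattoAppendixCLemma2.isPosSemidefKernel_condCov_freeCov`; `u = condMean`).
* §4 `dmoment_eq_integral_prod` (these moments ARE `LegDiagram.dmoment` on every family without observable), ★★
  **`abs_ursellOf_condField_monomials_le_exp`** — APPENDIX D FOR `P̄`: if `|u(x_l)| ≤ K₀` and `|C^Γ(x_a,x_b)| ≤ K₀e^{−δρ(a,b)}`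
  for a pseudo-distance `ρ` on the legs, then for ANY two legs `u₀, w₀`
  `|𝓔^T_{z̄}(z^{A_j}, j∈J)| ≤ 2^{|Λ|}·2^{2^{|Λ|}}·K₀^{|Λ|}·exp(−(δ/2)(ρ(u₀,w₀) − Σ_{same cluster}ρ))`
  (the sibling's `abs_ursellOf_dmoment_le_exp`); `…_le_exp'` — the propagator hypothesis moved to the FREE covariance by (C.6)
  `0 ≤ C^Γ ≤ C` (`B1Eq324BenfattoAppendixC2.condCov_freeCov_nonneg_le`).

HONEST SCOPE / NOT HERE.  (i) The corridor geometry of p. 166 — choosing `u₀` in `□′∖Γ₄(□)` and `w₀` in `Γ₂(□)` so that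
`ρ(u₀,w₀) ≥ b^{3/2}/2`, and absorbing the intra-cluster lengths into the Hamiltonian's `e^{−(ϰ/2)d(Δ₁…Δ_p)}` (point i)) — is the
boxes/corridors line's (`B1Eq324BenfattoSect5Boxes`); here `ρ`, `K₀`, `δ` are hypotheses, with (C.8)
(`B1Eq324BenfattoCondCentre.abs_condMean_freeCov_le'`) and (C.2) (`…AppendixC2.freeCov_le_decay`) the intended suppliers.
(ii) The diagram count `2^{|Λ|}2^{2^{|Λ|}}` is r14's crude `card_diags_le`, not print's `s₅`.  (iii) (5.30)–(5.32) and the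
p. 159 iteration are not here.  `BasicLemmaPrinted` stays OPEN.  NOT summit progress; count-neutral for N08; nothing of
[Balaban1985UV3] is asserted.
-/

open Finset MeasureTheory
open scoped BigOperators

namespace Literature.MathematicalPhysics.QuantumFieldTheory.Balaban1983to89.B1Eq324BenfattoAppendixDWick

open _root_.MeasureTheory _root_.ProbabilityTheory
open Literature.Probability.LatticeModels (setPartitions IsSetPartition mem_setPartitions setPartitions_empty
  sum_setPartitions_eq_sum_block ursellOf ursellOf_eq)
open Literature.Probability.LatticeModels.LegDiagram (legs mem_legs diags mem_diags IsDiag IsConn dval dmoment sum_diags)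
open Literature.Probability.Distributions (GaussianWick.integrable_prod)
open Literature.MathematicalPhysics.QuantumFieldTheory
open Literature.MathematicalPhysics.QuantumFieldTheory.Balaban1983to89.HiggsFluctMeasureWickSum (wickSum)
open Literature.MathematicalPhysics.QuantumFieldTheory.Balaban1983to89.HiggsFluctMeasureWickPairings
  (pairVal pairVal_pair pairVal_of_card_ne_two wickSum_eq_sum_setPartitions_pairVal filter_mem_card_two_eq_image
   injOn_pair sdiff_pair_eq_erase_erase)
open Literature.MathematicalPhysics.QuantumFieldTheory.Balaban1983to89.HiggsFluctMeasureWickPairingSum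
  (integral_finsetProd_eval_eq_wickSum)
open Literature.MathematicalPhysics.QuantumFieldTheory.Balaban1983to89.B1Eq323ConnectedGraphBound
  (allV some_mem_allV none_not_mem_allV)
open Literature.MathematicalPhysics.QuantumFieldTheory.Balaban1983to89.B1Eq324BenfattoAppendixDClustering
  (abs_ursellOf_dmoment_le_exp)
open Literature.MathematicalPhysics.QuantumFieldTheory.Balaban1983to89.B1Eq324BenfattoLemma
open Literature.MathematicalPhysics.QuantumFieldTheory.Balaban1983to89.B1Eq324BenfattoAppendixCLemma2
  (isPosSemidefKernel_condCov_freeCov)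
open Literature.MathematicalPhysics.QuantumFieldTheory.Balaban1983to89.B1Eq324BenfattoAppendixC2
  (condCov_freeCov_nonneg_le)

/-! ## §1  Combinatorics: set partitions into sources and pairs -/

section Combinatorics

variable {ι : Type*} [LinearOrder ι]

/-- **Block decomposition at a leg, for weights without higher blocks**: if `v B = 0` whenever `|B| ≥ 3`, then for `a ∈ r`
`Σ_{τ∈𝒫(r)} Π_{B∈τ} v B = v{a}·Σ_{τ∈𝒫(r∖a)} Π v + Σ_{b∈r∖a} v{a,b}·Σ_{τ∈𝒫(r∖{a,b})} Π v` (the block of `a` is `{a}` or a pair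
`{a,b}`; `LatticeModels.sum_setPartitions_eq_sum_block`). [folklore] -/
private theorem sum_setPartitions_block_step (v : Finset ι → ℝ) (hv3 : ∀ B : Finset ι, 3 ≤ B.card → v B = 0)
    {r : Finset ι} {a : ι} (ha : a ∈ r) :
    ∑ τ ∈ setPartitions r, ∏ B ∈ τ, v B =
      v {a} * (∑ τ ∈ setPartitions (r.erase a), ∏ B ∈ τ, v B) +
        ∑ b ∈ r.erase a, v {a, b} * ∑ τ ∈ setPartitions ((r.erase a).erase b), ∏ B ∈ τ, v B := by
  rw [sum_setPartitions_eq_sum_block ha]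
  have step1 : ∀ P₀ ∈ r.powerset.filter (fun P => a ∈ P), ∀ κ ∈ setPartitions (r \ P₀),
      ∏ B ∈ insert P₀ κ, v B = v P₀ * ∏ B ∈ κ, v B := fun P₀ hP₀ κ hκ =>
    prod_insert ((mem_setPartitions.1 hκ).notMem_of_sdiff ⟨a, (mem_filter.1 hP₀).2⟩)
  rw [sum_congr rfl fun P₀ hP₀ => sum_congr rfl fun κ hκ => step1 P₀ hP₀ κ hκ]
  simp_rw [← mul_sum]
  rw [← sum_filter_add_sum_filter_not (r.powerset.filter fun P => a ∈ P) (fun P => P.card = 2)]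
  have hpairs : ∑ P₀ ∈ (r.powerset.filter fun P => a ∈ P).filter (fun P => P.card = 2),
      v P₀ * ∑ κ ∈ setPartitions (r \ P₀), ∏ B ∈ κ, v B
      = ∑ b ∈ r.erase a, v {a, b} * ∑ τ ∈ setPartitions ((r.erase a).erase b), ∏ B ∈ τ, v B := by
    rw [filter_mem_card_two_eq_image r ha, sum_image (injOn_pair r a)]
    refine sum_congr rfl fun b _ => ?_
    rw [sdiff_pair_eq_erase_erase]
  have hrest : ∑ P₀ ∈ (r.powerset.filter fun P => a ∈ P).filter (fun P => ¬P.card = 2),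
      v P₀ * ∑ κ ∈ setPartitions (r \ P₀), ∏ B ∈ κ, v B
      = v {a} * ∑ τ ∈ setPartitions (r.erase a), ∏ B ∈ τ, v B := by
    rw [Finset.sum_eq_single {a}]
    · rw [sdiff_singleton_eq_erase]
    · intro P₀ hP₀ hne
      obtain ⟨hP₀', hc2⟩ := mem_filter.1 hP₀
      obtain ⟨-, haP⟩ := mem_filter.1 hP₀'
      have hc1 : P₀.card ≠ 1 := fun h1 => by
        obtain ⟨y, hy⟩ := card_eq_one.1 h1
        rw [hy, mem_singleton] at haP
        exact hne (by rw [hy, haP])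
      have hc0 : P₀.card ≠ 0 := by
        rw [Ne, card_eq_zero]
        exact ne_empty_of_mem haP
      rw [hv3 P₀ (by omega), zero_mul]
    · intro hnot
      exfalso
      exact hnot (mem_filter.2 ⟨mem_filter.2 ⟨mem_powerset.2 (singleton_subset_iff.2 ha), mem_singleton_self a⟩,
        by simp⟩)
  rw [hpairs, hrest, add_comm]

/-- **SOURCES AND PAIRS**: for block weights `w` vanishing on blocks of three or more legs, the sum over ALL set partitions of
`Π_B w(B)` is the sum over the set `t` of SOURCE legs (singleton blocks, weight `w{l}`) of the pairing sum of the others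
(pair blocks, weight `w{a,b}`): `Σ_{τ∈𝒫(s)} Π_{B∈τ} w B = Σ_{t⊆s} (Π_{l∈t} w{l})·Σ_{ρ∈𝒫(s∖t)} Π_{B∈ρ} w₂ B`,
`w₂ = w·[|B| = 2]` — the combinatorics of Wick's theorem WITH A SOURCE (mean).  Strong induction on `s` through
`sum_setPartitions_block_step` at the least leg. [cite: BenfattoEtAl1978, Appendix D p.166] -/
theorem sum_setPartitions_eq_sum_powerset_pairs (w : Finset ι → ℝ) (hw3 : ∀ B : Finset ι, 3 ≤ B.card → w B = 0)
    (s : Finset ι) :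
    ∑ τ ∈ setPartitions s, ∏ B ∈ τ, w B =
      ∑ t ∈ s.powerset, (∏ l ∈ t, w {l}) *
        ∑ ρ ∈ setPartitions (s \ t), ∏ B ∈ ρ, (if B.card = 2 then w B else 0) := by
  induction s using Finset.strongInduction with
  | H s ih =>
    set w₂ : Finset ι → ℝ := fun B => if B.card = 2 then w B else 0 with hw₂
    have hw₂3 : ∀ B : Finset ι, 3 ≤ B.card → w₂ B = 0 := fun B hB => by
      simp only [hw₂]
      rw [if_neg (by omega)]
    have hw₂1 : ∀ l : ι, w₂ {l} = 0 := fun l => by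
      simp only [hw₂, card_singleton]
      rw [if_neg (by omega)]
    have hw₂2 : ∀ a b : ι, a ≠ b → w₂ {a, b} = w {a, b} := fun a b hab => by
      simp only [hw₂, card_pair hab, if_true]
    by_cases h : s.Nonempty
    · have ha : s.min' h ∈ s := min'_mem s h
      set a := s.min' h with ha_def
      rw [sum_setPartitions_block_step w hw3 ha,
        ← sum_filter_add_sum_filter_not s.powerset (fun t => a ∈ t)]
      -- (i) the source sets containing `a`
      have hi : ∑ t ∈ s.powerset.filter (fun t => a ∈ t),
          (∏ l ∈ t, w {l}) * ∑ ρ ∈ setPartitions (s \ t), ∏ B ∈ ρ, w₂ B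
          = w {a} * ∑ t ∈ (s.erase a).powerset,
              (∏ l ∈ t, w {l}) * ∑ ρ ∈ setPartitions ((s.erase a) \ t), ∏ B ∈ ρ, w₂ B := by
        have himg : s.powerset.filter (fun t => a ∈ t) = (s.erase a).powerset.image (insert a) := by
          ext t
          simp only [mem_filter, mem_powerset, mem_image]
          constructor
          · rintro ⟨hts, hat⟩
            exact ⟨t.erase a, erase_subset_erase a hts, insert_erase hat⟩
          · rintro ⟨t', ht', rfl⟩
            exact ⟨insert_subset_iff.2 ⟨ha, ht'.trans (erase_subset a s)⟩, mem_insert_self a t'⟩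
        have hinj : Set.InjOn (insert a) ((s.erase a).powerset : Set (Finset ι)) := by
          intro t₁ ht₁ t₂ ht₂ heq
          have h1 : a ∉ t₁ := fun h => (mem_erase.1 (mem_powerset.1 (mem_coe.1 ht₁) h)).1 rfl
          have h2 : a ∉ t₂ := fun h => (mem_erase.1 (mem_powerset.1 (mem_coe.1 ht₂) h)).1 rfl
          rw [← erase_insert h1, heq, erase_insert h2]
        rw [himg, sum_image hinj, mul_sum]
        refine sum_congr rfl fun t' ht' => ?_
        have hat' : a ∉ t' := fun h => (mem_erase.1 (mem_powerset.1 ht' h)).1 rfl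
        have hset : s \ insert a t' = (s.erase a) \ t' := by
          ext y
          simp only [mem_sdiff, mem_insert, mem_erase, not_or]
          tauto
        rw [prod_insert hat', hset, mul_assoc]
      -- (ii) the source sets avoiding `a`: the block of `a` is a pair `{a, b}`
      have hii : ∑ t ∈ s.powerset.filter (fun t => ¬a ∈ t),
          (∏ l ∈ t, w {l}) * ∑ ρ ∈ setPartitions (s \ t), ∏ B ∈ ρ, w₂ B
          = ∑ b ∈ s.erase a, w {a, b} * ∑ t ∈ ((s.erase a).erase b).powerset,
              (∏ l ∈ t, w {l}) * ∑ ρ ∈ setPartitions (((s.erase a).erase b) \ t), ∏ B ∈ ρ, w₂ B := by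
        have hexp : ∀ t ∈ s.powerset.filter (fun t => ¬a ∈ t),
            (∏ l ∈ t, w {l}) * ∑ ρ ∈ setPartitions (s \ t), ∏ B ∈ ρ, w₂ B
              = ∑ b ∈ (s \ t).erase a,
                  w {a, b} * ((∏ l ∈ t, w {l}) * ∑ ρ ∈ setPartitions (((s \ t).erase a).erase b), ∏ B ∈ ρ, w₂ B) := by
          intro t ht
          obtain ⟨-, hat⟩ := mem_filter.1 ht
          have has : a ∈ s \ t := mem_sdiff.2 ⟨ha, hat⟩
          rw [sum_setPartitions_block_step w₂ hw₂3 has, hw₂1, zero_mul, zero_add, mul_sum]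
          refine sum_congr rfl fun b hb => ?_
          rw [hw₂2 a b (ne_of_mem_erase hb).symm]
          ring
        rw [sum_congr rfl hexp,
          sum_comm' (t' := s.erase a) (s' := fun b => ((s.erase a).erase b).powerset) ?_]
        · refine sum_congr rfl fun b _ => ?_
          rw [mul_sum]
          refine sum_congr rfl fun t _ => ?_
          have hset : ((s \ t).erase a).erase b = ((s.erase a).erase b) \ t := by
            ext y
            simp only [mem_erase, mem_sdiff]
            tauto
          rw [hset]
        · intro t b
          constructor
          · rintro ⟨ht, hb⟩
            obtain ⟨hts, hat⟩ := mem_filter.1 ht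
            rw [mem_powerset] at hts
            obtain ⟨hba, hbst⟩ := mem_erase.1 hb
            obtain ⟨hbs, hbt⟩ := mem_sdiff.1 hbst
            refine ⟨mem_powerset.2 fun y hy => mem_erase.2 ⟨fun hyb => hbt (hyb ▸ hy),
              mem_erase.2 ⟨fun hya => hat (hya ▸ hy), hts hy⟩⟩, mem_erase.2 ⟨hba, hbs⟩⟩
          · rintro ⟨ht, hb⟩
            rw [mem_powerset] at ht
            obtain ⟨hba, hbs⟩ := mem_erase.1 hb
            refine ⟨mem_filter.2 ⟨mem_powerset.2 fun y hy => (mem_erase.1 (mem_erase.1 (ht hy)).2).2,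
              fun hat => (mem_erase.1 (mem_erase.1 (ht hat)).2).1 rfl⟩,
              mem_erase.2 ⟨hba, mem_sdiff.2 ⟨hbs, fun hbt => (mem_erase.1 (ht hbt)).1 rfl⟩⟩⟩
      rw [hi, hii, ih (s.erase a) (erase_ssubset ha)]
      congr 1
      refine sum_congr rfl fun b hb => ?_
      rw [ih ((s.erase a).erase b) (lt_of_le_of_lt (erase_subset _ _) (erase_ssubset ha))]
    · have hs : s = ∅ := not_nonempty_iff_eq_empty.1 h
      rw [hs]
      simp [setPartitions_empty]

end Combinatorics

/-! ## §2  Wick's theorem WITH A SOURCE for a shifted kernel Gaussian field -/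

section Wick

variable {S : Type} [DecidableEq S] {K : S → S → ℝ} {κ : Type*} [LinearOrder κ]

/-- The shifted kernel field is a probability measure. [folklore] -/
private theorem isProbabilityMeasure_shift (hK : IsPosSemidefKernel K) (u : S → ℝ) :
    IsProbabilityMeasure ((gaussianFieldOfKernel K).map fun ζ y => u y + ζ y) := by
  haveI := isProbabilityMeasure_gaussianFieldOfKernel hK
  exact Measure.isProbabilityMeasure_map
    (measurable_pi_lambda _ fun y => measurable_const.add (measurable_pi_apply y)).aemeasurable

/-- **THE MOMENTS OF A GAUSSIAN FIELD WITH MEAN `u` AND COVARIANCE `K`**, sources-and-pairings form: for a finite family of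
coordinate legs `x : κ → S`,
`∫ Π_{l∈s} z(x_l) d[(μ_K)∘(u + ·)⁻¹] = Σ_{t⊆s} (Π_{l∈t} u(x_l)) · wickSum (K∘x) (s∖t)`
(`Finset.prod_add` + the centred Wick theorem `HiggsFluctMeasureWickPairingSum.integral_finsetProd_eval_eq_wickSum`).
[cite: BenfattoEtAl1978, Appendix D p.166] -/
theorem integral_prod_shift_eq_sum_powerset (hK : IsPosSemidefKernel K) (u : S → ℝ) (s : Finset κ) (x : κ → S) :
    ∫ z, ∏ l ∈ s, z (x l) ∂((gaussianFieldOfKernel K).map fun ζ y => u y + ζ y) =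
      ∑ t ∈ s.powerset, (∏ l ∈ t, u (x l)) * wickSum (fun i j => K (x i) (x j)) (s \ t) := by
  have hmeas : Measurable (fun (ζ : S → ℝ) (y : S) => u y + ζ y) :=
    measurable_pi_lambda _ fun y => measurable_const.add (measurable_pi_apply y)
  have hF : Measurable fun z : S → ℝ => ∏ l ∈ s, z (x l) :=
    Finset.measurable_prod s fun l _ => measurable_pi_apply (x l)
  rw [integral_map hmeas.aemeasurable hF.aestronglyMeasurable]
  have hexpand : ∀ ζ : S → ℝ, ∏ l ∈ s, (u (x l) + ζ (x l)) =
      ∑ t ∈ s.powerset, (∏ l ∈ t, u (x l)) * ∏ l ∈ s \ t, ζ (x l) := fun ζ =>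
    Finset.prod_add (fun l => u (x l)) (fun l => ζ (x l)) s
  simp_rw [hexpand]
  have hG := isGaussianProcess_eval_gaussianFieldOfKernel hK
  rw [integral_finsetSum _ fun t _ => (GaussianWick.integrable_prod hG (s \ t) x).const_mul _]
  refine sum_congr rfl fun t _ => ?_
  rw [integral_const_mul, integral_finsetProd_eval_eq_wickSum hK (s \ t) x]

/-- **WICK'S THEOREM WITH A SOURCE, SET-PARTITION FORM**: the same moments are the sum over ALL set partitions `τ` of the legs of
`Π_{B∈τ} w(B)` with the block weights `w{l} = u(x_l)` (a leg contracted to the SOURCE), `w{a,b} = K(x_a, x_b)` (a PROPAGATOR),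
`w(B) = 0` for `|B| ≥ 3` — «sum of products of 2-point functions» together with the mean insertions.
[cite: BenfattoEtAl1978, Appendix D p.166] -/
theorem integral_prod_shift_eq_sum_setPartitions (hK : IsPosSemidefKernel K) (u : S → ℝ) (s : Finset κ) (x : κ → S) :
    ∫ z, ∏ l ∈ s, z (x l) ∂((gaussianFieldOfKernel K).map fun ζ y => u y + ζ y) =
      ∑ τ ∈ setPartitions s, ∏ B ∈ τ,
        (if B.card = 1 then ∏ l ∈ B, u (x l) else pairVal (fun i j => K (x i) (x j)) B) := by
  set w : Finset κ → ℝ := fun B => if B.card = 1 then ∏ l ∈ B, u (x l) else pairVal (fun i j => K (x i) (x j)) B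
    with hw
  have hw3 : ∀ B : Finset κ, 3 ≤ B.card → w B = 0 := fun B hB => by
    simp only [hw]
    rw [if_neg (by omega), pairVal_of_card_ne_two _ (by omega)]
  have hw1 : ∀ l, w {l} = u (x l) := fun l => by
    simp only [hw, card_singleton, if_true, prod_singleton]
  have hw2 : ∀ B : Finset κ, (if B.card = 2 then w B else 0) = pairVal (fun i j => K (x i) (x j)) B := fun B => by
    by_cases h2 : B.card = 2
    · simp only [h2, if_true, hw]
      rw [if_neg (by omega)]
    · rw [if_neg h2, pairVal_of_card_ne_two _ h2]
  rw [integral_prod_shift_eq_sum_powerset hK u s x, sum_setPartitions_eq_sum_powerset_pairs w hw3 s]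
  refine sum_congr rfl fun t _ => ?_
  rw [prod_congr rfl fun l _ => hw1 l, wickSum_eq_sum_setPartitions_pairVal]
  congr 1
  refine sum_congr rfl fun ρ _ => prod_congr rfl fun B _ => ?_
  rw [hw2 B]

end Wick

/-! ## §3  The conditioned free field `P̄ = condField d α β Γ z̄` -/

section CondField

variable {d : ℕ} {α β : ℝ} {κ : Type*} [LinearOrder κ]

/-- **THE MOMENTS OF MONOMIALS UNDER `P̄(dz|z̄_Γ)`** (mean `u = condMean`, covariance `C^Γ = condCov`, (C.7)/(C.6)): for legs
`x : κ → Q₀`, `∫ Π_{l∈s} z(x_l) dP̄ = Σ_{τ∈𝒫(s)} Π_{B∈τ} w(B)` with `w{l} = u(x_l)`, `w{a,b} = C^Γ(x_a,x_b)`, `0` on larger blocks.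
[cite: BenfattoEtAl1978, Appendix D p.166 and Appendix C 2) p.164] -/
theorem integral_prod_eval_condField_eq_sum_setPartitions (hα : 0 < α) (hβ : 0 < β)
    (Γ : Finset (B1Eq324BenfattoLemma.Site d)) (zbar : B1Eq324BenfattoLemma.Site d → ℝ) (s : Finset κ)
    (x : κ → B1Eq324BenfattoLemma.Site d) :
    ∫ z, ∏ l ∈ s, z (x l) ∂condField d α β Γ zbar =
      ∑ τ ∈ setPartitions s, ∏ B ∈ τ,
        (if B.card = 1 then ∏ l ∈ B, condMean (freeCov d α β) Γ zbar (x l)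
          else pairVal (fun i j => condCov (freeCov d α β) Γ (x i) (x j)) B) := by
  rw [condField]
  exact integral_prod_shift_eq_sum_setPartitions (isPosSemidefKernel_condCov_freeCov hα hβ Γ) _ s x

end CondField

/-! ## §4  Appendix D for the conditioned free field: exponential clustering of the truncated expectations of monomials -/

section Clustering

variable {d : ℕ} {α β : ℝ}
variable {J : Type} [Fintype J] [DecidableEq J] {Λ : Type} [Fintype Λ] [LinearOrder Λ] (own : Λ → J)

/-- Locality of the Ursell function (private copy, as in the sibling files). [folklore] -/
private theorem ursellOf_congr {γ : Type*} [DecidableEq γ] {m m' : Finset γ → ℝ} {V : Finset γ}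
    (h : ∀ P ⊆ V, m P = m' P) : ursellOf m V = ursellOf m' V := by
  induction V using Finset.strongInduction with
  | H V ih =>
    rw [ursellOf_eq, ursellOf_eq, h V Subset.rfl]
    congr 1
    refine sum_congr rfl fun π hπ => prod_congr rfl fun P hP => ?_
    obtain ⟨hne, hπ'⟩ := mem_erase.1 hπ
    have hsp := mem_setPartitions.1 hπ'
    have hPV : P ⊂ V := hsp.ssubset_of_ne_singleton hne hP
    exact ih P hPV fun Q hQ => h Q (hQ.trans hPV.subset)

omit [Fintype J] in
/-- **THE MOMENTS OF THE CLUSTERS ARE DIAGRAM MOMENTS**: for a vertex family `P` without the observable, the joint moment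
`∫ Π_{l ∈ legs P} z(x_l) dP̄` IS p13's `LegDiagram.dmoment own w ω P` with the source/propagator weights of
`integral_prod_eval_condField_eq_sum_setPartitions` (any observable weight `ω`: it is never read).
[cite: BenfattoEtAl1978, Appendix D p.166] -/
theorem dmoment_eq_integral_prod (hα : 0 < α) (hβ : 0 < β) (Γ : Finset (B1Eq324BenfattoLemma.Site d))
    (zbar : B1Eq324BenfattoLemma.Site d → ℝ) (x : Λ → B1Eq324BenfattoLemma.Site d) (ω : Finset Λ → ℝ)
    {P : Finset (Option J)} (hP : none ∉ P) :
    dmoment own (fun B => if B.card = 1 then ∏ l ∈ B, condMean (freeCov d α β) Γ zbar (x l)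
        else pairVal (fun i j => condCov (freeCov d α β) Γ (x i) (x j)) B) ω P =
      ∫ z, ∏ l ∈ legs own P, z (x l) ∂condField d α β Γ zbar := by
  rw [integral_prod_eval_condField_eq_sum_setPartitions hα hβ Γ zbar (legs own P) x, dmoment, sum_diags]
  have hD : (legs own P).powerset.filter (fun D => D.Nonempty → none ∈ P) = {∅} := by
    ext D
    simp only [mem_filter, mem_powerset, mem_singleton]
    constructor
    · rintro ⟨-, h⟩
      by_contra hne
      exact hP (h (nonempty_iff_ne_empty.2 hne))
    · rintro rfl
      exact ⟨empty_subset _, fun h => absurd h (by simp)⟩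
  rw [hD, sum_singleton, sdiff_empty]
  refine sum_congr rfl fun τ _ => ?_
  rw [dval, if_neg hP, mul_one]

/-- **APPENDIX D FOR THE CONDITIONED FREE FIELD** — «the only terms that survive are the so called "connected diagrams" … the
exponential factors … give rise to an overall dumping factor»: let the legs `Λ` (the factors `z_Δ` of the monomial clusters
`own : Λ → J`, all clusters present) sit at tesserae `x : Λ → Q₀`, and let `ρ` be a pseudo-distance on the legs such that the
conditioned mean and covariance obey `|u(x_l)| ≤ K₀`, `|C^Γ(x_a,x_b)| ≤ K₀e^{−δρ(a,b)}` (`K₀ ≥ 1`, `δ ≥ 0`; on print's objects: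
(C.8) and (C.6)+(C.2)).  Then the joint truncated expectation of the clusters under `P̄(dz|z̄_Γ)` satisfies, for ANY two legs,
`|𝓔^T_{z̄}(z^{A_j}, j ∈ J)| ≤ 2^{|Λ|}·2^{2^{|Λ|}}·K₀^{|Λ|}·exp(−(δ/2)(ρ(u₀,w₀) − Σ_{same cluster}ρ))`
(`dmoment_eq_integral_prod` + `B1Eq324BenfattoAppendixDClustering.abs_ursellOf_dmoment_le_exp`).
[cite: BenfattoEtAl1978, Appendix D p.166] -/
theorem abs_ursellOf_condField_monomials_le_exp [Nonempty J] (hα : 0 < α) (hβ : 0 < β)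
    (Γ : Finset (B1Eq324BenfattoLemma.Site d)) (zbar : B1Eq324BenfattoLemma.Site d → ℝ)
    (x : Λ → B1Eq324BenfattoLemma.Site d) (ρ : Λ → Λ → ℝ) {K₀ δ : ℝ}
    (h0 : ∀ a, ρ a a = 0) (hsymm : ∀ a b, ρ a b = ρ b a) (htri : ∀ a b c, ρ a c ≤ ρ a b + ρ b c)
    (hnn : ∀ a b, 0 ≤ ρ a b) (hK₀ : 1 ≤ K₀) (hδ : 0 ≤ δ)
    (hu : ∀ l, |condMean (freeCov d α β) Γ zbar (x l)| ≤ K₀)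
    (hC : ∀ a b, |condCov (freeCov d α β) Γ (x a) (x b)| ≤ K₀ * Real.exp (-(δ * ρ a b))) (u₀ w₀ : Λ) :
    |ursellOf (fun P : Finset (Option J) => ∫ z, ∏ l ∈ legs own P, z (x l) ∂condField d α β Γ zbar) (allV J)| ≤
      2 ^ Fintype.card Λ * 2 ^ 2 ^ Fintype.card Λ * (K₀ ^ Fintype.card Λ *
        Real.exp (-(δ / 2 * (ρ u₀ w₀ - ∑ p ∈ univ.filter (fun p : Λ × Λ => own p.1 = own p.2), ρ p.1 p.2)))) := by
  set w : Finset Λ → ℝ := fun B => if B.card = 1 then ∏ l ∈ B, condMean (freeCov d α β) Γ zbar (x l)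
      else pairVal (fun i j => condCov (freeCov d α β) Γ (x i) (x j)) B with hw
  have hloc : ursellOf (fun P : Finset (Option J) => ∫ z, ∏ l ∈ legs own P, z (x l) ∂condField d α β Γ zbar) (allV J)
      = ursellOf (dmoment own w (fun _ => 0)) (allV J) := by
    refine ursellOf_congr fun P hP => ?_
    rw [dmoment_eq_integral_prod own hα hβ Γ zbar x (fun _ => 0) fun h => none_not_mem_allV (hP h)]
  rw [hloc]
  refine abs_ursellOf_dmoment_le_exp own ρ w (fun _ => 0) h0 hsymm htri hnn hK₀ hδ ?_ ?_ ?_ u₀ w₀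
  · intro l
    simp only [hw, card_singleton, if_true, prod_singleton]
    exact hu l
  · intro a b hab
    simp only [hw, card_pair hab]
    rw [if_neg (by omega)]
    rcases lt_or_gt_of_ne hab with h | h
    · rw [pairVal_pair _ h]
      exact hC a b
    · rw [pair_comm, pairVal_pair _ h, hsymm a b]
      exact hC b a
  · intro B hB
    simp only [hw]
    rw [if_neg (by omega), pairVal_of_card_ne_two _ (by omega)]

/-- The same with the propagator hypothesis placed on the FREE covariance: by (C.6) `0 ≤ C^Γ ≤ C`
(`B1Eq324BenfattoAppendixC2.condCov_freeCov_nonneg_le`) a decay bound `C(x_a,x_b) ≤ K₀e^{−δρ(a,b)}` for the free covariance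
((C.2) `freeCov_le_decay` on print's lattice) suffices. [cite: BenfattoEtAl1978, Appendix D p.166 and (C.2), (C.6) p.164] -/
theorem abs_ursellOf_condField_monomials_le_exp' [Nonempty J] (hα : 0 < α) (hβ : 0 < β)
    (Γ : Finset (B1Eq324BenfattoLemma.Site d)) (zbar : B1Eq324BenfattoLemma.Site d → ℝ)
    (x : Λ → B1Eq324BenfattoLemma.Site d) (ρ : Λ → Λ → ℝ) {K₀ δ : ℝ}
    (h0 : ∀ a, ρ a a = 0) (hsymm : ∀ a b, ρ a b = ρ b a) (htri : ∀ a b c, ρ a c ≤ ρ a b + ρ b c)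
    (hnn : ∀ a b, 0 ≤ ρ a b) (hK₀ : 1 ≤ K₀) (hδ : 0 ≤ δ)
    (hu : ∀ l, |condMean (freeCov d α β) Γ zbar (x l)| ≤ K₀)
    (hC : ∀ a b, freeCov d α β (x a) (x b) ≤ K₀ * Real.exp (-(δ * ρ a b))) (u₀ w₀ : Λ) :
    |ursellOf (fun P : Finset (Option J) => ∫ z, ∏ l ∈ legs own P, z (x l) ∂condField d α β Γ zbar) (allV J)| ≤
      2 ^ Fintype.card Λ * 2 ^ 2 ^ Fintype.card Λ * (K₀ ^ Fintype.card Λ *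
        Real.exp (-(δ / 2 * (ρ u₀ w₀ - ∑ p ∈ univ.filter (fun p : Λ × Λ => own p.1 = own p.2), ρ p.1 p.2)))) := by
  refine abs_ursellOf_condField_monomials_le_exp own hα hβ Γ zbar x ρ h0 hsymm htri hnn hK₀ hδ hu (fun a b => ?_) u₀ w₀
  obtain ⟨h1, h2⟩ := condCov_freeCov_nonneg_le (d := d) hα hβ Γ (x a) (x b)
  rw [abs_of_nonneg h1]
  exact h2.trans (hC a b)

end Clustering

/-! ## §5  (v1.1) Print's lattice: the `ℓ¹` instance — propagator decay from (C.2)/(C.6), distance = the `ℓ¹` distance of the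
## legs' tesserae, rate `δ = log((2d + α²)/2d)` -/

section Lattice

open Literature.MathematicalPhysics.QuantumFieldTheory.Balaban1983to89.B1Eq324BenfattoAppendixC2
  (freeCov_le_self_mul_pow_l1)

variable {d : ℕ} {α β : ℝ}
variable {J : Type} [Fintype J] [DecidableEq J] {Λ : Type} [Fintype Λ] [LinearOrder Λ] (own : Λ → J)

omit [Fintype J] [DecidableEq J] [Fintype Λ] [LinearOrder Λ] in
/-- The `ℓ¹` distance of the legs' tesserae, `ρ(a,b) = Σ_j |x_a(j) − x_b(j)|`, is a pseudo-distance. [folklore] -/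
private theorem l1_pseudo (x : Λ → B1Eq324BenfattoLemma.Site d) :
    (∀ a, (∑ j, |((x a j : ℝ) - (x a j : ℝ))|) = 0) ∧
    (∀ a b, (∑ j, |((x a j : ℝ) - (x b j : ℝ))|) = ∑ j, |((x b j : ℝ) - (x a j : ℝ))|) ∧
    (∀ a b c, (∑ j, |((x a j : ℝ) - (x c j : ℝ))|) ≤
      (∑ j, |((x a j : ℝ) - (x b j : ℝ))|) + ∑ j, |((x b j : ℝ) - (x c j : ℝ))|) ∧
    (∀ a b, 0 ≤ ∑ j, |((x a j : ℝ) - (x b j : ℝ))|) := by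
  refine ⟨fun a => by simp, fun a b => Finset.sum_congr rfl fun j _ => abs_sub_comm _ _, fun a b c => ?_,
    fun a b => Finset.sum_nonneg fun j _ => abs_nonneg _⟩
  rw [← Finset.sum_add_distrib]
  exact Finset.sum_le_sum fun j _ => abs_sub_le _ _ _

omit [Fintype J] [DecidableEq J] [Fintype Λ] [LinearOrder Λ] in
/-- **(C.2)+(C.6) AS THE PROPAGATOR HYPOTHESIS OF APPENDIX D**: on print's lattice `|C^Γ(x_a, x_b)| ≤ C(x_a, x_b) ≤
C_{00}·(2d/(2d+α²))^{ℓ¹(x_a,x_b)} = C_{00}·exp(−δρ(a,b))` with `δ = log((2d+α²)/(2d))` and `ρ` the `ℓ¹` leg distance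
(`B1Eq324BenfattoAppendixC2.freeCov_le_self_mul_pow_l1`, `condCov_freeCov_nonneg_le`; `d ≥ 1`).
[cite: BenfattoEtAl1978, Appendix C (C.2), (C.6) p.164] -/
theorem abs_condCov_le_exp_l1 (hα : 0 < α) (hβ : 0 < β) (hd : 0 < d) (Γ : Finset (B1Eq324BenfattoLemma.Site d))
    (x : Λ → B1Eq324BenfattoLemma.Site d) (a b : Λ) :
    |condCov (freeCov d α β) Γ (x a) (x b)| ≤ freeCov d α β 0 0 *
      Real.exp (-(Real.log ((2 * d + α ^ 2) / (2 * d)) * ∑ j, |((x a j : ℝ) - (x b j : ℝ))|)) := by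
  obtain ⟨h1, h2⟩ := condCov_freeCov_nonneg_le (d := d) hα hβ Γ (x a) (x b)
  rw [abs_of_nonneg h1]
  refine h2.trans ((freeCov_le_self_mul_pow_l1 hα hβ (x a) (x b)).trans_eq ?_)
  congr 1
  have hd' : (0 : ℝ) < 2 * d := by positivity
  have hr : (0 : ℝ) < 2 * d / (2 * d + α ^ 2) := by positivity
  have hsum : (∑ j, |((x a j : ℝ) - (x b j : ℝ))|) = ((∑ j, (x a j - x b j).natAbs : ℕ) : ℝ) := by
    push_cast
    refine Finset.sum_congr rfl fun j _ => ?_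
    rw [← Int.cast_sub, Nat.cast_natAbs, Int.cast_abs]
  rw [hsum, ← Real.rpow_natCast, Real.rpow_def_of_pos hr, Real.log_div (by positivity) hd'.ne',
    Real.log_div hd'.ne' (by positivity)]
  congr 1
  ring

/-- **APPENDIX D ON PRINT'S LATTICE**: for the conditioned free field `P̄(dz|z̄_Γ)` in dimension `d ≥ 1`, monomial clusters with
legs at tesserae `x : Λ → Q₀`, a bound `K₀ ≥ max(1, C_{00})` dominating the conditioned mean on the legs (`|u(x_l)| ≤ K₀`, (C.8)),
and ANY two legs `u₀, w₀`:
`|𝓔^T_{z̄}(z^{A_j}, j∈J)| ≤ 2^{|Λ|}·2^{2^{|Λ|}}·K₀^{|Λ|}·exp(−(δ/2)(ℓ¹(x_{u₀},x_{w₀}) − Σ_{same cluster}ℓ¹))`, `δ = log((2d+α²)/(2d))`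
— the propagator hypothesis discharged by (C.2)/(C.6) (`abs_condCov_le_exp_l1`).
[cite: BenfattoEtAl1978, Appendix D p.166 and Appendix C (C.2), (C.6) p.164] -/
theorem abs_ursellOf_condField_monomials_le_exp_l1 [Nonempty J] (hα : 0 < α) (hβ : 0 < β) (hd : 0 < d)
    (Γ : Finset (B1Eq324BenfattoLemma.Site d)) (zbar : B1Eq324BenfattoLemma.Site d → ℝ)
    (x : Λ → B1Eq324BenfattoLemma.Site d) {K₀ : ℝ} (hK₀ : 1 ≤ K₀) (hK₀' : freeCov d α β 0 0 ≤ K₀)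
    (hu : ∀ l, |condMean (freeCov d α β) Γ zbar (x l)| ≤ K₀) (u₀ w₀ : Λ) :
    |ursellOf (fun P : Finset (Option J) => ∫ z, ∏ l ∈ legs own P, z (x l) ∂condField d α β Γ zbar) (allV J)| ≤
      2 ^ Fintype.card Λ * 2 ^ 2 ^ Fintype.card Λ * (K₀ ^ Fintype.card Λ *
        Real.exp (-(Real.log ((2 * d + α ^ 2) / (2 * d)) / 2 *
          ((∑ j, |((x u₀ j : ℝ) - (x w₀ j : ℝ))|) -
            ∑ p ∈ univ.filter (fun p : Λ × Λ => own p.1 = own p.2), ∑ j, |((x p.1 j : ℝ) - (x p.2 j : ℝ))|)))) := by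
  obtain ⟨h0, hsymm, htri, hnn⟩ := l1_pseudo (d := d) x
  have hδ : 0 ≤ Real.log ((2 * d + α ^ 2) / (2 * d)) := by
    have hd' : (0 : ℝ) < 2 * d := by positivity
    refine Real.log_nonneg ?_
    rw [le_div_iff₀ hd']
    nlinarith [pow_pos hα 2]
  refine abs_ursellOf_condField_monomials_le_exp own hα hβ Γ zbar x
    (fun a b => ∑ j, |((x a j : ℝ) - (x b j : ℝ))|) h0 hsymm htri hnn hK₀ hδ hu (fun a b => ?_) u₀ w₀
  refine (abs_condCov_le_exp_l1 hα hβ hd Γ x a b).trans ?_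
  exact mul_le_mul_of_nonneg_right hK₀' (Real.exp_pos _).le

end Lattice

end Literature.MathematicalPhysics.QuantumFieldTheory.Balaban1983to89.B1Eq324BenfattoAppendixDWick
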